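import Summits.QuantumFields.YangMills.Theorems.UnitScaleTiltProp7ChartLandauSplit
import Summits.QuantumFields.YangMills.Theorems.UnitScaleTiltProp7SymAvgTwSymDefs
import Summits.QuantumFields.YangMills.Theorems.UnitScaleTiltProp7SPrintDefsS
import HarnessLib

/-!
# Route `UnitScaleTilt`, crux K1 child «MinimiserStabilityRegPr» (stmt-QuantumFields-19200), skeleton v10, stub `stub_existenceMinimalOrbit` (EX), route (α) — **(CH-KNIT v2ˢ) FILE Iˢ:
# THE (21)-ROW SPLIT IN THE LETTERS OF RECORD** — the (α-S)∕№12 twin of ✓`Prop7ChartLandauSplit` §3 (`hXtw'_of_splitL`): the chart remainder is `Dfix (CmapTwS U₀) H C₂` (symmetric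
# centre-anchored frames, ★★OWNER RULING g26-№12) and the E–L clause quantifies over the `NormS`-normalised representatives (RULING g26-№19); the linear algebra — (1.38) is a
# ℂ-subspace condition, ★`isLandauPrint_of_split` ((21) for `X` with `iX = A′ − H·D` from (102)-L, (129)-L, (45)) — is frame-free and IMPORTED from ✓`Prop7ChartLandauSplit`

Cell `ym3-torus`, width seat `ym-ust-19200-w2` (gen 3; EX KNIT RULER).  THEOREMS ONLY (0 `def`, 0 `sorry`).  Linear-algebra bookkeeping: nothing here closes the stub; `--supports
stmt-QuantumFields-19200 --as helper`, count-neutral.  YM₃ on T³ is a ladder rung (R3), not the Clay problem; nothing here claims the stub, the crux, d = 4 or the mass gap.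

THE PRINT.  [Balaban1985Variational] p. 285: «H is a linear operator … satisfying QH = I, RD*H = 0 (45)»; p. 289 (76): «the configuration A given by (47) satisfies also the second
condition in (21) if RD*A′ = 0 because RD*HD(A′) = 0»; p. 293–294 (102)–(103), (111)–(112); [Balaban1985BackgroundPropagators] (3.124) p. 420, (3.147)–(3.153) pp. 425–426;
[Balaban1985RegularSpaces] (1.38) p. 82.

WHAT IS PROVED (sorry-free, no definition).  ★★ **`hXtw'_of_splitLS`** — the (CH5EL-twˢ)′ display `hXtw′` (∃ X: Hermitian-traceless, `A′ − H·Dfix(CmapTwS U₀)(A′) = iX` at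
`A′ = iη·ι(A₁ + H₁ Bsym)`, (19)-size, (21), E–L at the `NormS`-representatives) FROM the thinner display `hXtw″` (the same WITHOUT (21)) and the three rows (102)-L
`∀ f, IsLandauPrint U₀ (ι(𝔊f))`, (129)-L `∀ B, IsLandauPrint U₀ (ι(H₁B))`, (45)-twˢ `∀ Y, IsLandauPrint U₀ (HY)` — by ✓`isLandauPrint_of_split` verbatim.  HONEST SCOPE: bookkeeping;
the XL content ((112) ∘ Prop. 5 ∘ (123)–(140) ∘ E–L) stays displayed in `hXtw″`.

References: T. Bałaban, CMP 102 (1985) 277–309 [Balaban1985Variational] ((21) p.281, (45)–(47) p.285, (76) p.289, (102)–(103) p.293, (111)–(112) p.294, (129) p.297); CMP 99 (1985)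
389–434 [Balaban1985BackgroundPropagators] ((3.124) p.420, (3.147)–(3.153) pp.425–426); CMP 99 (1985) 75–102 [Balaban1985RegularSpaces] ((1.38) p.82).
-/

set_option autoImplicit false

noncomputable section

open scoped Matrix.Norms.L2Operator

namespace Summit.QuantumFields.YangMills.Theorems.Prop7ChartLandauSplitS

open NormedSpace
open Literature.MathematicalPhysics.QuantumFieldTheory.Balaban1983to89
open Literature.MathematicalPhysics.QuantumFieldTheory.Balaban1983to89.T3ContinuumYM3Torus
open Literature.MathematicalPhysics.QuantumFieldTheory.Balaban1983to89.T3UnitLawDensityEML (ℰp)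
open Literature.MathematicalPhysics.QuantumFieldTheory.Balaban1983to89.T3TiltDescent (descendTo)
open Literature.MathematicalPhysics.QuantumFieldTheory.Balaban1983to89.T3ConstrainedMinimiser (fibre)
open Literature.MathematicalPhysics.QuantumFieldTheory.Balaban1983to89.T3SectALandauChart (emb15 eta eta_pos)
open B7Prop1Explicit renaming Site → LSite
open B8Eq138LandauZd (IsLandau138 covDivB covLap QT)
open B9SectCLatticeCarrier (Bond)
open B10Eq27TorusAxialLog (pull unitsField toUField)
open B11Eq115Space (NegSize Space115 JetSup)
open B11Eq111FrakG (nabla115)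
open B11Eq98CurrentSlot (Jcur)
open B11Prop3Model (Dfix)
open MatrixLog (mlog)
open Summit.QuantumFields.YangMills.Theorems.Prop7TPrint (nMax19 expHermField)
open Summit.QuantumFields.YangMills.Theorems.Prop7SPrint (basePt IsLandauPrint NormS)
open Summit.QuantumFields.YangMills.Theorems.Prop7SectET3Transport (periodsT3 bgOfCfg bondEquiv)
open Summit.QuantumFields.YangMills.Theorems.Prop7SymAvgTwSym (QTwS CmapTwS)
open Summit.QuantumFields.YangMills.Theorems.Prop7ChartLandauSplit (isLandauPrint_of_split)

section Split

variable (F : T3Family) {n K : ℕ} (h : n ≤ K) [Fact (0 < (F.L : ℝ))] [Fact (0 < ((F.L : ℝ)⁻¹) ^ (K - n))]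
  {V : GaugeField (F.P n) 0 (Matrix.specialUnitaryGroup (Fin 2) ℂ)} {U₀ : GaugeField (F.P K) 0 (Matrix.specialUnitaryGroup (Fin 2) ℂ)}
  {𝒢 : NegSize (F.L : ℝ) (((F.L : ℝ)⁻¹) ^ (K - n)) (fun _ : Bond 3 (periodsT3 F K) => K - n) 3 (Matrix (Fin 2) (Fin 2) ℂ) →L[ℂ]
        Space115 (F.L : ℝ) (((F.L : ℝ)⁻¹) ^ (K - n)) (fun _ : Bond 3 (periodsT3 F K) => K - n) (fun _ : Bond 3 (periodsT3 F K) × Fin 3 => K - n)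
          (nabla115 (((F.L : ℝ)⁻¹) ^ (K - n)) (bgOfCfg F K U₀))}
  {W : Space115 (F.L : ℝ) (((F.L : ℝ)⁻¹) ^ (K - n)) (fun _ : Bond 3 (periodsT3 F K) => K - n) (fun _ : Bond 3 (periodsT3 F K) × Fin 3 => K - n)
          (nabla115 (((F.L : ℝ)⁻¹) ^ (K - n)) (bgOfCfg F K U₀)) →
        NegSize (F.L : ℝ) (((F.L : ℝ)⁻¹) ^ (K - n)) (fun _ : Bond 3 (periodsT3 F K) => K - n) 3 (Matrix (Fin 2) (Fin 2) ℂ)}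
  {H₁ : (PBond (F.P n) 0 → Matrix (Fin 2) (Fin 2) ℂ) →L[ℂ]
        Space115 (F.L : ℝ) (((F.L : ℝ)⁻¹) ^ (K - n)) (fun _ : Bond 3 (periodsT3 F K) => K - n) (fun _ : Bond 3 (periodsT3 F K) × Fin 3 => K - n)
          (nabla115 (((F.L : ℝ)⁻¹) ^ (K - n)) (bgOfCfg F K U₀))}
  {H : (PBond (F.P n) 0 → Matrix (Fin 2) (Fin 2) ℂ) →ₗ[ℂ] (PBond (F.P K) 0 → Matrix (Fin 2) (Fin 2) ℂ)}

/-! ## The knit's (CH5EL-twˢ)′ display from the thinner display without (21), letters of record -/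

/-- ★★ **THE (CH5EL-twˢ)′ DISPLAY `hXtw′` OF THE v2.6ˢ KNIT `Prop7StubEXOfChartPiecesTwS` (chart remainder `Dfix (CmapTwS U₀) H C₂`, E–L at the `NormS`-representatives) FROM THE THINNER DISPLAY `hXtw″` AND THE ROWS (102)-L ∕ (129)-L ∕ (45)-tw**:
`hXtw″` delivers, for every solution `A₁` of (111) in the (115)-ball, an exponent `X` — Hermitian-traceless, chart identity `A′ − H(DA′) = iX` at `A′ = iη·ι(A₁ + H₁ Bsym)`, (19)-size, E–L —
and (21) `IsLandauPrint U₀ X` is SUPPLIED by `isLandauPrint_of_split`.  After this lemma the XL row of the EX knit reads: (112) ∘ Prop. 5 (reality) ∘ (123)–(140) ((19)-size) ∘ E–L.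
[cite: Balaban1985Variational, (21) p.281, (76) p.289, (102)–(103) p.293, (112) p.294, Prop. 5 p.294, (123)–(140) pp.296–299] -/
theorem hXtw'_of_splitLS {ε₄ M C₂ : ℝ}
    (h102L : ∀ f : NegSize (F.L : ℝ) (((F.L : ℝ)⁻¹) ^ (K - n)) (fun _ : Bond 3 (periodsT3 F K) => K - n) 3 (Matrix (Fin 2) (Fin 2) ℂ),
      IsLandauPrint F n K U₀ (fun b : PBond (F.P K) 0 => JetSup.equiv _ _ _ (𝒢 f) (bondEquiv F K b)))
    (h129L : ∀ B : PBond (F.P n) 0 → Matrix (Fin 2) (Fin 2) ℂ,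
      IsLandauPrint F n K U₀ (fun b : PBond (F.P K) 0 => JetSup.equiv _ _ _ (H₁ B) (bondEquiv F K b)))
    (h45 : ∀ Y : PBond (F.P n) 0 → Matrix (Fin 2) (Fin 2) ℂ, IsLandauPrint F n K U₀ (H Y))
    -- the thinner display: (112) ∘ Prop. 5 ∘ (123)–(140) ∘ E–L, WITHOUT (21)
    (hXtw'' : ∀ A₁ : Space115 (F.L : ℝ) (((F.L : ℝ)⁻¹) ^ (K - n)) (fun _ : Bond 3 (periodsT3 F K) => K - n) (fun _ : Bond 3 (periodsT3 F K) × Fin 3 => K - n)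
            (nabla115 (((F.L : ℝ)⁻¹) ^ (K - n)) (bgOfCfg F K U₀)),
      ‖A₁‖ < ε₄ → A₁ + 𝒢 (Jcur (bgOfCfg F K U₀)) + 𝒢 (W (A₁ + H₁ (fun c : PBond (F.P n) 0 =>
        (-Complex.I) • mlog (((V c : Matrix.specialUnitaryGroup (Fin 2) ℂ) : Matrix (Fin 2) (Fin 2) ℂ)
          * star ((descendTo F ℰp n K h U₀ c : Matrix.specialUnitaryGroup (Fin 2) ℂ) : Matrix (Fin 2) (Fin 2) ℂ))))) = 0 →
        ∃ X : PBond (F.P K) 0 → Matrix (Fin 2) (Fin 2) ℂ,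
          (∀ b : PBond (F.P K) 0, (X b).IsHermitian ∧ Matrix.trace (X b) = 0) ∧
          (((eta F n K : ℝ) : ℂ) * Complex.I) • ((fun b : PBond (F.P K) 0 => JetSup.equiv _ _ _ A₁ (bondEquiv F K b))
              + (fun b : PBond (F.P K) 0 => JetSup.equiv _ _ _ (H₁ (fun c : PBond (F.P n) 0 =>
                  (-Complex.I) • mlog (((V c : Matrix.specialUnitaryGroup (Fin 2) ℂ) : Matrix (Fin 2) (Fin 2) ℂ)
                    * star ((descendTo F ℰp n K h U₀ c : Matrix.specialUnitaryGroup (Fin 2) ℂ) : Matrix (Fin 2) (Fin 2) ℂ)))) (bondEquiv F K b)))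
            - H (Dfix (CmapTwS F n K h U₀) H C₂
              ((((eta F n K : ℝ) : ℂ) * Complex.I) • ((fun b : PBond (F.P K) 0 => JetSup.equiv _ _ _ A₁ (bondEquiv F K b))
              + (fun b : PBond (F.P K) 0 => JetSup.equiv _ _ _ (H₁ (fun c : PBond (F.P n) 0 =>
                  (-Complex.I) • mlog (((V c : Matrix.specialUnitaryGroup (Fin 2) ℂ) : Matrix (Fin 2) (Fin 2) ℂ)
                    * star ((descendTo F ℰp n K h U₀ c : Matrix.specialUnitaryGroup (Fin 2) ℂ) : Matrix (Fin 2) (Fin 2) ℂ)))) (bondEquiv F K b)))))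
            = (fun b => Complex.I • X b) ∧
          nMax19 F n K U₀ X ≤ M * (‖A₁‖ + ‖H₁ (fun c : PBond (F.P n) 0 =>
            (-Complex.I) • mlog (((V c : Matrix.specialUnitaryGroup (Fin 2) ℂ) : Matrix (Fin 2) (Fin 2) ℂ)
              * star ((descendTo F ℰp n K h U₀ c : Matrix.specialUnitaryGroup (Fin 2) ℂ) : Matrix (Fin 2) (Fin 2) ℂ)))‖) ∧
          (∀ u : GaugeTransf (F.P K) 0 (Matrix.specialUnitaryGroup (Fin 2) ℂ), NormS F n K h U₀ X (expHermField X) u →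
            GaugeField.gaugeAct u (emb15 U₀ (expHermField X)) ∈ fibre F ℰp n K h V →
            ∀ γ : ℝ → GaugeField (F.P K) 0 (Matrix.specialUnitaryGroup (Fin 2) ℂ), γ 0 = GaugeField.gaugeAct u (emb15 U₀ (expHermField X)) →
              (∀ t, γ t ∈ fibre F ℰp n K h V) →
              (∀ b, DifferentiableAt ℝ (fun t => ((γ t b : Matrix.specialUnitaryGroup (Fin 2) ℂ) : Matrix (Fin 2) (Fin 2) ℂ)) 0) →
                deriv (fun t => wilsonAction4 (γ t)) 0 = 0)) :
    ∀ A₁ : Space115 (F.L : ℝ) (((F.L : ℝ)⁻¹) ^ (K - n)) (fun _ : Bond 3 (periodsT3 F K) => K - n) (fun _ : Bond 3 (periodsT3 F K) × Fin 3 => K - n)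
          (nabla115 (((F.L : ℝ)⁻¹) ^ (K - n)) (bgOfCfg F K U₀)),
      ‖A₁‖ < ε₄ → A₁ + 𝒢 (Jcur (bgOfCfg F K U₀)) + 𝒢 (W (A₁ + H₁ (fun c : PBond (F.P n) 0 =>
        (-Complex.I) • mlog (((V c : Matrix.specialUnitaryGroup (Fin 2) ℂ) : Matrix (Fin 2) (Fin 2) ℂ)
          * star ((descendTo F ℰp n K h U₀ c : Matrix.specialUnitaryGroup (Fin 2) ℂ) : Matrix (Fin 2) (Fin 2) ℂ))))) = 0 →
        ∃ X : PBond (F.P K) 0 → Matrix (Fin 2) (Fin 2) ℂ,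
          (∀ b : PBond (F.P K) 0, (X b).IsHermitian ∧ Matrix.trace (X b) = 0) ∧
          (((eta F n K : ℝ) : ℂ) * Complex.I) • ((fun b : PBond (F.P K) 0 => JetSup.equiv _ _ _ A₁ (bondEquiv F K b))
              + (fun b : PBond (F.P K) 0 => JetSup.equiv _ _ _ (H₁ (fun c : PBond (F.P n) 0 =>
                  (-Complex.I) • mlog (((V c : Matrix.specialUnitaryGroup (Fin 2) ℂ) : Matrix (Fin 2) (Fin 2) ℂ)
                    * star ((descendTo F ℰp n K h U₀ c : Matrix.specialUnitaryGroup (Fin 2) ℂ) : Matrix (Fin 2) (Fin 2) ℂ)))) (bondEquiv F K b)))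
            - H (Dfix (CmapTwS F n K h U₀) H C₂
              ((((eta F n K : ℝ) : ℂ) * Complex.I) • ((fun b : PBond (F.P K) 0 => JetSup.equiv _ _ _ A₁ (bondEquiv F K b))
              + (fun b : PBond (F.P K) 0 => JetSup.equiv _ _ _ (H₁ (fun c : PBond (F.P n) 0 =>
                  (-Complex.I) • mlog (((V c : Matrix.specialUnitaryGroup (Fin 2) ℂ) : Matrix (Fin 2) (Fin 2) ℂ)
                    * star ((descendTo F ℰp n K h U₀ c : Matrix.specialUnitaryGroup (Fin 2) ℂ) : Matrix (Fin 2) (Fin 2) ℂ)))) (bondEquiv F K b)))))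
            = (fun b => Complex.I • X b) ∧
          nMax19 F n K U₀ X ≤ M * (‖A₁‖ + ‖H₁ (fun c : PBond (F.P n) 0 =>
            (-Complex.I) • mlog (((V c : Matrix.specialUnitaryGroup (Fin 2) ℂ) : Matrix (Fin 2) (Fin 2) ℂ)
              * star ((descendTo F ℰp n K h U₀ c : Matrix.specialUnitaryGroup (Fin 2) ℂ) : Matrix (Fin 2) (Fin 2) ℂ)))‖) ∧
          IsLandauPrint F n K U₀ X ∧
          (∀ u : GaugeTransf (F.P K) 0 (Matrix.specialUnitaryGroup (Fin 2) ℂ), NormS F n K h U₀ X (expHermField X) u →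
            GaugeField.gaugeAct u (emb15 U₀ (expHermField X)) ∈ fibre F ℰp n K h V →
            ∀ γ : ℝ → GaugeField (F.P K) 0 (Matrix.specialUnitaryGroup (Fin 2) ℂ), γ 0 = GaugeField.gaugeAct u (emb15 U₀ (expHermField X)) →
              (∀ t, γ t ∈ fibre F ℰp n K h V) →
              (∀ b, DifferentiableAt ℝ (fun t => ((γ t b : Matrix.specialUnitaryGroup (Fin 2) ℂ) : Matrix (Fin 2) (Fin 2) ℂ)) 0) →
                deriv (fun t => wilsonAction4 (γ t)) 0 = 0) := by
  intro A₁ hA₁ h111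
  obtain ⟨X, hX, hAX, hsize, hEL⟩ := hXtw'' A₁ hA₁ h111
  exact ⟨X, hX, hAX, hsize, isLandauPrint_of_split F h h102L h129L h45 A₁ h111 hAX, hEL⟩

end Split

end Summit.QuantumFields.YangMills.Theorems.Prop7ChartLandauSplitS

end
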